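import Literature.NumberTheory.GaloisRepresentations.LubinTateComparisonTraceTransportTwo
import Literature.NumberTheory.GaloisRepresentations.LubinTateColemanRelativeTraceTwo
import HarnessLib

/-!
# `q = 2`, RELATIVE coefficients: from Coleman's `𝒮_E G = 0` over `𝒪_E` (`E ⊇ F` finite, e.g. the
# unramified base `k'`) to the vanishing of the `Ĝ_m`-trace of `G ∘ ϑ` at all `2`-power roots of unity in `ℂ_F`

Topic `NumberTheory/GaloisRepresentations`; namespace `Literature.NumberTheory.GaloisRepresentations`.

De Shalit's construction (1987, I.3.3, I.3.8; III.1.3) is run over an UNRAMIFIED base `k'`: the Coleman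
power series of the two-variable tower have coefficients in `𝒪_{k'}` (tree `relTraceTwo`, `reflE`, file
`LubinTateColemanRelativeTraceTwo.lean`: `(𝒮_E G) ∘ f' = G + G(−π' − X)` for every finite `E ⊇ F` at
`q = 2`).  This file is the `𝒪_E`-coefficient twin of `LubinTateComparisonTraceTransportTwo.lean`:

* ★ `evS_map_reflE` — the ℂ_F-side REFLECTION LAW, hypothesis-free in `G ∈ 𝒪_E⟦X⟧`: for the images in
  `𝒪_{ℂ_F}⟦X⟧`, **`(τ_E G)(y) = G(−π' − y)` on `𝔪_ℂ`** (`reflE` is `evT` at the point `X [+] (−π') = −π' − X`;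
  `map_evT` along `unitBallToCBall E`, then `evS_evT`) — appended by the typer seat `bsd-print-cf2-ty2` g46 as port
  P62 (§B) of the stub-critic's plan for crux stmt-BirchSwinnertonDyer-27851 (sketch k1-g43 `c394c15f3c926eba` C1);
* ★ `evS_map_reflect_of_reflE_eq_neg` — its special case `G(−π' − X) = −G` in `𝒪_E⟦X⟧` (`reflE … G = −G`) ⟹
  **`h(−π' − y) = −h(y)` on `𝔪_ℂ`**;
* ★ `reflE_eq_neg_of_relTraceTwo_eq_zero` — `𝒮_E G = 0 ⟹ G(−π' − X) = −G`;
* ★★★ `sum_nthRootsFinset_tsum_eq_zero_of_relTraceTwo_eq_zero` — **for `G ∈ 𝒪_E⟦X⟧` with `𝒮_E G = 0`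
  (`f' = π'X + X²`, `π' = u·2`) and `H := G ∘ ϑ ∈ 𝒪_{ℂ_F}⟦S⟧`: `Σ_{w² = 1} Σ_m H_m (ζw − 1)^m = 0` for every
  `ζ ∈ ℂ_F` with `ζ^{2^n} = 1`** — the hypothesis of the support criterion (de Shalit (7) ⟹ (7′)) for the
  measures of the two-variable tower.

Everything is proved; no named facts, no definitions, no instances, no `sorry`.

## References

* [deShalit1987] E. de Shalit, *Iwasawa theory of elliptic curves with complex multiplication* (1987),
  I.3.3 (7)–(7′) (p. 17), I.3.8, I.3.12 (23); III.1.3.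
* [CasselsFrohlichANT1967] J.-P. Serre, *Local class field theory*, Ch. VI of Cassels–Fröhlich (1967), §3.2.
-/

noncomputable section

open MvPowerSeries
open scoped PowerSeries.WithPiTopology

namespace Literature.NumberTheory.GaloisRepresentations

section TraceTransportRelTwo

open ValuativeRel IsLocalRing Field IsNonarchimedeanLocalField LubinTate
open Literature.NumberTheory.PAdicHodge

variable {F : Type} [Field F] [ValuativeRel F] [TopologicalSpace F] [IsNonarchimedeanLocalField F]

attribute [local instance] ltNormUniformSpace ltNormIsUniformAddGroup rk1 nF nE fintypeResidueField

variable (hq : residueFieldCard F = 2) (h2 : (valuation F).IsUniformizer (((2 : ℕ) : 𝒪[F]) : F))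
  {σ₀ : absoluteGaloisGroup F} (hσ₀ : IsAbsArithFrob σ₀) (u : 𝒪[F]ˣ)
  {ε : (maxUnramifiedCompletion F)ˣ}
  (hε : maxUnramifiedCompletion.galAut F σ₀ (ε : maxUnramifiedCompletion F) =
    algebraMap 𝒪[F] (maxUnramifiedCompletion F) (u : 𝒪[F]) * (ε : maxUnramifiedCompletion F))
variable (E : IntermediateField F (AlgebraicClosure F)) [FiniteDimensional F E]

/-- The element `π'` of `𝒪_E`, pushed to `ℂ_F`, is `π' ∈ F ⊆ ℂ_F`. [cite: CasselsFrohlichANT1967, Ch. VI §3.2] -/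
theorem coe_unitBallToCBall_algebraMap (a : 𝒪[F]) :
    ((unitBallToCBall E (algebraMap 𝒪[F] (unitBall E) a) : CBall F) : CompletedAlgClosure F) =
      algebraMap F (CompletedAlgClosure F) (a : F) := by
  have h : algebraMap 𝒪[F] (unitBall E) a = algebraMap (LTCoeff F) (unitBall E) (LTCoeff.of F a) := rfl
  rw [h, unitBallToCBall_algebraMap, coe_algebraMap_intToUnrCoeff]
  rfl

include hq in
/-- ★ **The ℂ_F-side reflection law `(τ_E G)(y) = G(−π' − y)` on `𝔪_ℂ`**, hypothesis-free in `G ∈ 𝒪_E⟦X⟧`: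
for the images in `𝒪_{ℂ_F}⟦X⟧` of `τ_E G = reflE … G = G(X [+] (−π'))` and of `G`, evaluation at `y ∈ 𝔪_ℂ` of the
former is evaluation at `y' = −π' − y` of the latter (`reflE` is `evT` at the point `X [+] (−π') = −π' − X`; push
along `𝒪_E → 𝒪_{ℂ_F}` with `map_evT` and evaluate with `evS_evT`).  `evS_map_reflect_of_reflE_eq_neg` below is the
special case `τ_E G = −G`. [cite: deShalit1987, I.3.3 (7) (p. 17)] -/
theorem evS_map_reflE {π' : 𝒪[F]} (hπ' : (valuation F).IsUniformizer (π' : F))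
    (G : PowerSeries (unitBall E)) (y y' : (maxNilIdealC F).toIdeal)
    (hy' : ((y' : CBall F) : CompletedAlgClosure F) =
      -algebraMap F (CompletedAlgClosure F) (π' : F) - ((y : CBall F) : CompletedAlgClosure F)) :
    evS (maxNilIdealC F) y ((reflE hπ' E G).map (unitBallToCBall E)) =
      evS (maxNilIdealC F) y' (G.map (unitBallToCBall E)) := by
  set ψ : unitBall E →+* CBall F := unitBallToCBall E with hψ
  set t₁ := tPt (maxNilIdeal F E) (isLTRing_LTCoeff hπ') (isLTSeries_LTCoeff π') (divPtTwo hπ' E 1) with ht₁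
  have h1 : reflE hπ' E G = evT (maxNilIdeal F E) t₁ G := by rw [ht₁]; exact reflE_apply hπ' E G
  have ht₁C : PowerSeries.map ψ (t₁ : PowerSeries (unitBall E)) =
      -PowerSeries.X - PowerSeries.C (ψ (algebraMap 𝒪[F] (unitBall E) π')) := by
    rw [ht₁, coe_tPt_divPtTwo hπ' E hq one_ne_zero, map_sub, map_neg, PowerSeries.map_X, PowerSeries.map_C]
  have hπC : ((ψ (algebraMap 𝒪[F] (unitBall E) π') : CBall F) : CompletedAlgClosure F) =
      algebraMap F (CompletedAlgClosure F) (π' : F) := coe_unitBallToCBall_algebraMap E π'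
  have htmem : PowerSeries.map ψ (t₁ : PowerSeries (unitBall E)) ∈ (seriesNilIdeal (maxNilIdealC F)).toIdeal := by
    rw [mem_seriesNilIdeal_iff, ht₁C, map_sub, map_neg, PowerSeries.constantCoeff_X, neg_zero, zero_sub,
      PowerSeries.constantCoeff_C]
    refine neg_mem ?_
    change ‖((ψ (algebraMap 𝒪[F] (unitBall E) π') : CBall F) : CompletedAlgClosure F)‖ < 1
    rw [hπC, CompletedAlgClosure.norm_algebraMap]
    exact (norm_lt_one_iff F _).mpr hπ'.val_lt_one
  have hmap := congrArg (PowerSeries.map ψ) h1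
  rw [map_evT (maxNilIdeal F E) (maxNilIdealC F) ψ (continuous_unitBallToCBall E) t₁ htmem] at hmap
  have hev := congrArg (evS (maxNilIdealC F) y) hmap
  rw [evS_evT] at hev
  have hpt : evSPt (maxNilIdealC F) y ⟨PowerSeries.map ψ (t₁ : PowerSeries (unitBall E)), htmem⟩ = y' := by
    apply Subtype.ext; apply Subtype.ext
    change (((evS (maxNilIdealC F) y (PowerSeries.map ψ (t₁ : PowerSeries (unitBall E)))) : CBall F) :
      CompletedAlgClosure F) = _
    rw [ht₁C, map_sub, map_neg, evS_X, evS_C, hy']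
    push_cast
    rw [hπC]
    ring
  rw [hpt] at hev
  exact hev

include hq in
/-- ★ **`G(−π' − X) = −G` in `𝒪_E⟦X⟧` ⟹ `h(−π' − y) = −h(y)` on `𝔪_ℂ`** for the image `h` of `G` in
`𝒪_{ℂ_F}⟦X⟧` — the special case `τ_E G = −G` of `evS_map_reflE`. [cite: deShalit1987, I.3.3 (7) (p. 17)] -/
theorem evS_map_reflect_of_reflE_eq_neg {π' : 𝒪[F]} (hπ' : (valuation F).IsUniformizer (π' : F))
    (G : PowerSeries (unitBall E)) (hr : reflE hπ' E G = -G)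
    (y y' : (maxNilIdealC F).toIdeal)
    (hy' : ((y' : CBall F) : CompletedAlgClosure F) =
      -algebraMap F (CompletedAlgClosure F) (π' : F) - ((y : CBall F) : CompletedAlgClosure F)) :
    evS (maxNilIdealC F) y' (G.map (unitBallToCBall E)) = -evS (maxNilIdealC F) y (G.map (unitBallToCBall E)) := by
  have h := evS_map_reflE hq E hπ' G y y' hy'
  rw [hr, map_neg, map_neg] at h
  exact h.symm

include hq in
/-- ★ **`𝒮_E G = 0 ⟹ G(−π' − X) = −G`** (`(𝒮_E G) ∘ f' = G + G(−π' − X)` at `q = 2`).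
[cite: deShalit1987, I.3.12 (23), I.3.3 (7)] -/
theorem reflE_eq_neg_of_relTraceTwo_eq_zero {π' : 𝒪[F]} (hπ' : (valuation F).IsUniformizer (π' : F))
    (G : PowerSeries (unitBall E)) (hS : relTraceTwo hπ' E hq G = 0) : reflE hπ' E G = -G := by
  have h := subst_relTraceTwo hπ' E hq G
  rw [hS, ← PowerSeries.coe_substAlgHom (PowerSeries.HasSubst.of_constantCoeff_zero'
    ((isLTSeries_ltSer π').map _).constantCoeff_eq_zero), map_zero] at h
  linear_combination -h

include hq in
/-- ★★★ **End to end at `q = 2`, relative coefficients**: for `G ∈ 𝒪_E⟦X⟧` with `𝒮_E G = 0`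
(`f' = π'X + X²`, `π' = u·2`, Coleman's trace operator with coefficients in `𝒪_E`, `E ⊇ F` finite) and
`H := G ∘ ϑ ∈ 𝒪_{ℂ_F}⟦S⟧` (`ϑ = compSeriesC : Ĝ_m → F_{f'}`), **`Σ_{w² = 1} Σ_m H_m (ζw − 1)^m = 0` for every
`2`-power root of unity `ζ ∈ ℂ_F`** — de Shalit's (7) ⟹ (7′) for the measures of the two-variable tower
(unramified base). [cite: deShalit1987, I.3.3 (7)–(7′) (p. 17), I.3.8] -/
theorem sum_nthRootsFinset_tsum_eq_zero_of_relTraceTwo_eq_zero (G : PowerSeries (unitBall E))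
    (hS : relTraceTwo (isUniformizer_unit_mul h2 u) E hq G = 0)
    {ζ : CompletedAlgClosure F} {m : ℕ} (hζ : ζ ^ 2 ^ m = 1) :
    ∑ w ∈ Polynomial.nthRootsFinset 2 (1 : CompletedAlgClosure F),
      ∑' k : ℕ, ((PowerSeries.coeff k
          (PowerSeries.subst ((compSeriesC h2 hσ₀ u hε).map (algebraMap (UnrCoeff F) (CBall F)))
            (G.map (unitBallToCBall E))) : CBall F) : CompletedAlgClosure F) * (ζ * w - 1) ^ k = 0 :=
  sum_nthRootsFinset_tsum_coeff_subst_compSeriesC_eq_zero hq h2 hσ₀ u hε _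
    (fun y y' hy' ↦ evS_map_reflect_of_reflE_eq_neg hq E (isUniformizer_unit_mul h2 u) G
      (reflE_eq_neg_of_relTraceTwo_eq_zero hq E _ G hS) y y' hy') hζ

end TraceTransportRelTwo

end Literature.NumberTheory.GaloisRepresentations

end
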